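import Summits.NavierStokesRegularity.NavierStokesRegularity.Theorems.CorkscrewDynamoCorkscrewProfileRotatingWaveProfileEq
import Literature.Analysis.FluidPDE.AncientSimilarityVorticity
import Literature.Analysis.FluidPDE.PineauVicolEnstrophyTime
import HarnessLib

/-!
# Route CorkscrewDynamo · crux `CorkscrewProfile` (stmt-NavierStokesRegularity-11282) — tool stub V1: the vorticity equation of a rotated Leray profile

Tool stub `stub_rotatedVorticityEq` of line `registered` (skeleton v13, lead c6): for a smooth
solution `(U, P)` of PERELMAN'S ROTATED LERAY PROFILE SYSTEM
`α (J U − DU[J y]) + ½U + ½DU[y] − ΔU + DU[U] + ∇P = 0`, `div U = 0` on `ℝ³`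
(`J = rotGen = e₃ × ·`, a relative equilibrium of Leray's backward self-similar system rotating
about `e₃`), the vorticity `ω = curl U` solves
`Δω = Dω[U + ½y − αJy] + ω + αJω − DU[ω]`.

Proof (the co-rotating frame): the rotating wave `W(s, y) = R_{αs} U(R_{−αs} y)` with the pressure
`Q(s, y) = P(R_{−αs} y)` is a classical solution of Leray's backward system on `ℝ × ℝ³`
(`stub_corotatingFrame` with the pinned family `rotZLIE`), so its vorticity `Ω = curl W` obeys the
transport–stretching equation `∂ₛΩ + Ω + ½(y·∇)Ω + (W·∇)Ω = (Ω·∇)W + ΔΩ`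
(`IsBackwardLeraySolutionOn.vorticity_eq`). At `s = 0`: `W(0) = U`, `Ω(s, y) = R_{αs} ω(R_{−αs} y)`
(equivariance of the curl, `curl_rotZ_conj`) and `∂ₛΩ(0, y) = α (Jω(y) − Dω(y)[Jy])`
(`hasDerivAt_rotatingWave_zero`).
-/

noncomputable section

open MeasureTheory Set Function Filter Topology InnerProductSpace Metric
open Literature.Analysis.FluidPDE Literature.Analysis.FluidPDE.PineauVicol2026
open scoped RealInnerProductSpace Laplacian ContDiff NNReal ENNReal

namespace Summit.NavierStokesRegularity.NavierStokesRegularity.Theorems.CorkscrewProfile.Birth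

set_option linter.dupNamespace false

/-- **The rotating wave of a rotated Leray profile solves Leray's backward system.** If `(U, P)` is a
smooth divergence-free solution of Perelman's rotated profile system
`α (J U − DU[J y]) + ½U + ½DU[y] − ΔU + DU[U] + ∇P = 0`, then the rotating wave
`W(s, y) = R_{αs} U(R_{−αs} y)`, `Q(s, y) = P(R_{−αs} y)` is a classical solution of
`∂ₛW + ½W + ½DW[y] + DW[W] + ∇Q = ΔW`, `div W = 0` on `ℝ × ℝ³` (the co-rotating frame dictionary
`stub_corotatingFrame` for the pinned rotation family `rotZLIE`, `e₃ × v = J v`). [folklore] -/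
theorem isBackwardLeraySolutionOn_rotatingWave {α : ℝ}
    {U : EuclideanSpace ℝ (Fin 3) → EuclideanSpace ℝ (Fin 3)} {P : EuclideanSpace ℝ (Fin 3) → ℝ}
    (hU : ContDiff ℝ (⊤ : ℕ∞) U) (hP : ContDiff ℝ (⊤ : ℕ∞) P) (hdiv : VectorCalculus.IsDivFree U)
    (heq : ∀ y : EuclideanSpace ℝ (Fin 3),
      α • (rotGen (U y) - fderiv ℝ U y (rotGen y)) + (1 / 2 : ℝ) • U y + (1 / 2 : ℝ) • fderiv ℝ U y y
        - (Δ U) y + fderiv ℝ U y (U y) + gradient P y = 0) :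
    IsBackwardLeraySolutionOn Set.univ 1 (fun s y => rotZ (α * s) (U (rotZ (-(α * s)) y)))
      (fun s y => P (rotZ (-(α * s)) y)) := by
  -- `rotZLIE` is a rotation family about `e₃` pinned by coordinates
  have hRot : ∀ (φ : ℝ) (x : EuclideanSpace ℝ (Fin 3)),
      rotZLIE φ x 0 = Real.cos φ * x 0 - Real.sin φ * x 1 ∧
      rotZLIE φ x 1 = Real.sin φ * x 0 + Real.cos φ * x 1 ∧ rotZLIE φ x 2 = x 2 :=
    fun φ x => ⟨by simp, by simp, by simp⟩
  -- the profile system in the `e₃ × ·` / `convect` vocabulary of `stub_corotatingFrame`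
  have hEq' : ∀ y : EuclideanSpace ℝ (Fin 3),
      α • (cross (EuclideanSpace.single (2 : Fin 3) (1 : ℝ)) (U y)
            - fderiv ℝ U y (cross (EuclideanSpace.single (2 : Fin 3) (1 : ℝ)) y))
        + (1 / 2 : ℝ) • U y + (1 / 2 : ℝ) • fderiv ℝ U y y + convect U U y + gradient P y
        = Laplacian.laplacian U y := by
    intro y
    have h := heq y
    rw [cross_single_two_eq_rotGen, cross_single_two_eq_rotGen, convect_apply]
    refine sub_eq_zero.mp ?_
    rw [← h]
    abel
  have hL := stub_corotatingFrame rotZLIE α U P hRot hU hP hdiv hEq'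
  simpa only [rotZLIE_apply] using hL

/-- **The vorticity equation of a rotated Leray profile** (tool stub `stub_rotatedVorticityEq` of
the birth line of `CorkscrewDynamo.CorkscrewProfile`). For a smooth solution `(U, P)` of
`α (J U − DU[J y]) + ½U + ½DU[y] − ΔU + DU[U] + ∇P = 0`, `div U = 0` (`J = rotGen`), the
vorticity `ω = curl U` solves `Δω = Dω[U + ½y − αJy] + ω + αJω − DU[ω]`: the vorticity equation
`∂ₛΩ + Ω + ½(y·∇)Ω + (W·∇)Ω = (Ω·∇)W + ΔΩ` (`IsBackwardLeraySolutionOn.vorticity_eq`,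
Majda–Bertozzi Prop. 2.4 in similarity variables) of the rotating wave `W(s, y) = R_{αs} U(R_{−αs} y)`
(`isBackwardLeraySolutionOn_rotatingWave`) at `s = 0`, where `W(0) = U`,
`Ω(s, y) = R_{αs} ω(R_{−αs} y)` (`curl_rotZ_conj`) and `∂ₛΩ(0, y) = α (Jω(y) − Dω(y)[Jy])`
(`hasDerivAt_rotatingWave_zero`). [cite: MajdaBertozziCUP2002, §2.4 Prop. 2.4 eq. (2.110)] -/
theorem stub_rotatedVorticityEq {α : ℝ}
    {U : EuclideanSpace ℝ (Fin 3) → EuclideanSpace ℝ (Fin 3)} {P : EuclideanSpace ℝ (Fin 3) → ℝ}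
    (hU : ContDiff ℝ (⊤ : ℕ∞) U) (hP : ContDiff ℝ (⊤ : ℕ∞) P) (hdiv : VectorCalculus.IsDivFree U)
    (heq : ∀ y : EuclideanSpace ℝ (Fin 3),
      α • (rotGen (U y) - fderiv ℝ U y (rotGen y)) + (1 / 2 : ℝ) • U y + (1 / 2 : ℝ) • fderiv ℝ U y y
        - (Δ U) y + fderiv ℝ U y (U y) + gradient P y = 0) :
    ∀ y : EuclideanSpace ℝ (Fin 3),
      (Δ (curl U)) y = fderiv ℝ (curl U) y (U y + (1 / 2 : ℝ) • y - α • rotGen y) + curl U y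
        + α • rotGen (curl U y) - fderiv ℝ U y (curl U y) := by
  intro y
  have hL := isBackwardLeraySolutionOn_rotatingWave hU hP hdiv heq
  have hUd : Differentiable ℝ U := hU.differentiable (by simp)
  have hU2 : ContDiff ℝ 2 U := hU.of_le (WithTop.coe_le_coe.2 le_top)
  have hω1 : ContDiff ℝ 1 (curl U) := contDiff_curl (n := 1) (by exact_mod_cast hU2)
  have hωd : Differentiable ℝ (curl U) := hω1.differentiable (by simp)
  -- the vorticity equation of the rotating wave at `s = 0`
  have hcl : (univ : Set ℝ) ⊆ closure (interior univ) := by simp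
  have key := hL.vorticity_eq uniqueDiffOn_univ hcl (mem_univ (0 : ℝ)) y
  -- the vorticity of the wave is the rotating wave of the vorticity
  have hvort : vorticity (fun s y => rotZ (α * s) (U (rotZ (-(α * s)) y))) =
      fun s y => rotZ (α * s) (curl U (rotZ (-(α * s)) y)) := by
    funext s z
    exact curl_rotZ_conj hUd (α * s) z
  -- its time derivative at `s = 0`
  have htd : timeDerivWithin univ (vorticity (fun s y => rotZ (α * s) (U (rotZ (-(α * s)) y)))) 0 y =
      α • (rotGen (curl U y) - fderiv ℝ (curl U) y (rotGen y)) := by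
    rw [timeDerivWithin_eq_deriv isOpen_univ (mem_univ (0 : ℝ)), hvort]
    exact (hasDerivAt_rotatingWave_zero hωd y).deriv
  -- the slices at `s = 0`
  have hW0 : (fun z => rotZ (α * 0) (U (rotZ (-(α * 0)) z))) = U := by
    funext z
    rw [mul_zero, neg_zero, rotZ_zero, rotZ_zero]
  have hV0 : vorticity (fun s y => rotZ (α * s) (U (rotZ (-(α * s)) y))) 0 = curl U := by
    funext z
    show curl (fun z => rotZ (α * 0) (U (rotZ (-(α * 0)) z))) z = curl U z
    rw [hW0]
  beta_reduce at key
  rw [htd, hV0, hW0, convect_apply, convect_apply, one_smul] at key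
  -- linear algebra
  have e : (Δ (curl U)) y = α • (rotGen (curl U y) - fderiv ℝ (curl U) y (rotGen y)) + curl U y
      + (1 / 2 : ℝ) • fderiv ℝ (curl U) y y + fderiv ℝ (curl U) y (U y) - fderiv ℝ U y (curl U y) := by
    rw [key]
    abel
  rw [e, map_sub, map_add, (fderiv ℝ (curl U) y).map_smul, (fderiv ℝ (curl U) y).map_smul]
  module

end Summit.NavierStokesRegularity.NavierStokesRegularity.Theorems.CorkscrewProfile.Birth
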